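import Literature.AnabelianGeometry.AbsoluteAnabelian.MLFIntegerLatticeProofs
import Mathlib.GroupTheory.Index
import HarnessLib

/-!
# `(U_K : U_K^p) = p^{[K:ℚ_p]}` for a finite extension `K/ℚ_p` without `p`-th roots of unity
# (Neukirch, ANT Ch. II Cor. (5.8), the case `n = p`, `μ_p(K) = 1`; proofs only)

Topic `NumberTheory/LocalFields`; namespace `Literature.NumberTheory.LocalFields`. THEOREMS ONLY (no
definition, no named fact). For a finite extension `K` of `ℚ_p`, carried as a non-archimedean local
field with a `ℚ_p`-algebra structure (the setting of the tree's
`Literature.AnabelianGeometry.AbsoluteAnabelian.exists_oneUnits_continuousMulEquiv`: an open subgroup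
of finite index `W ≤ U_K = 𝒪_Kˣ` with `W ≃ ℤ_p^{[K:ℚ_p]}`, Neukirch II (5.7) (i)), whose unit group has
no element of order `p`:

J. Neukirch, *Algebraic Number Theory*, Ch. II (5.8) Corollary: "one finds the following indices for
the subgroups of `n`-th powers … `(U : Uⁿ) = #μ_n(K) · p^{d v_p(n)}`", `d = [K : ℚ_p]`; here `n = p`,
`#μ_p(K) = 1`, so **`(U_K : U_Kᵖ) = p^{[K:ℚ_p]}`** (`index_pow_range_units_integer_eq`). The tree's
`PadicPowerClassIndex.lean` is the case `K = ℚ_p` (all `n`); this file is the case of a general finite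
`K/ℚ_p` at `n = p` without `p`-torsion, which is what the Kummer count of unramified-at-`p` classes
over the layers of the cyclotomic `ℤ₃`-tower of `ℚ` consumes (cell `bsd-eis`, seat `bsd-eis-x3`,
x3-MEMO-11: the layers `ℚ(ζ_{3^{n+1}})⁺` complete at `3` to fields of odd degree `3ⁿ` over `ℚ₃`,
which contain no primitive cube root of unity).

Proof (no logarithm, no filtration): with `W ≃ ℤ_p^d` of finite index `N` in `U = U_K` and the
INJECTIVE endomorphism `f = (·)^p` of `U` (no `p`-torsion): `[U : W^p] = [U : W]·[W : W^p] = N·p^d`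
(`ℤ_p^d / pℤ_p^d ≃ (ℤ/p)^d`) and `[U : W^p] = [U : U^p]·[U^p : W^p] = [U : U^p]·N` (`f` is an
isomorphism `U ≃ U^p` carrying `W` onto `W^p`), whence `[U : U^p] = p^d`.

* `index_pow_range_pi_padicInt` — `(ℤ_p^d : p·ℤ_p^d) = p^d` (reduction mod `p` coordinatewise);
* `index_pow_range_eq_of_injective_of_subgroup` — the group-theoretic count: `f = (·)^p` injective on an
  abelian group `G`, `W ≤ G` of finite index with `[W : W^p] = m` ⟹ `[G : G^p] = m`;
* `index_pow_range_units_integer_eq` — **`(U_K : U_K^p) = p^{[K:ℚ_p]}`** for `K/ℚ_p` finite with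
  `U_K[p] = 1`.

## References
* J. Neukirch, *Algebraic Number Theory*, Grundlehren 322, Springer 1999, Ch. II (5.7), Cor. (5.8).
  [NeukirchANT1999]
* J.-P. Serre, *Local Fields*, GTM 67, Ch. XIV §4 (structure of `U_K`). [SerreLocalFields1979]
-/

noncomputable section

namespace Literature.NumberTheory.LocalFields

/-! ## §1. `(ℤ_p^d : pℤ_p^d) = p^d` -/

section PadicInt

variable {p : ℕ} [hp : Fact p.Prime]

/-- **`(ℤ_p^d : p ℤ_p^d) = p^d`**: the `p`-th power subgroup of `Multiplicative (Fin d → ℤ_p)` is the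
kernel of the coordinatewise reduction onto `(ℤ/p)^d`. [cite: NeukirchANT1999, Ch. II Cor. (5.8) (proof)] -/
theorem index_pow_range_pi_padicInt (d : ℕ) :
    (powMonoidHom p : Multiplicative (Fin d → ℤ_[p]) →* Multiplicative (Fin d → ℤ_[p])).range.index =
      p ^ d := by
  classical
  let R : (Fin d → ℤ_[p]) →+ (Fin d → ZMod p) :=
    AddMonoidHom.pi fun i => ((PadicInt.toZMod : ℤ_[p] →+* ZMod p).toAddMonoidHom).comp
      (Pi.evalAddMonoidHom (fun _ : Fin d => ℤ_[p]) i)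
  let F : Multiplicative (Fin d → ℤ_[p]) →* Multiplicative (Fin d → ZMod p) := R.toMultiplicative
  have hR : ∀ x : Fin d → ℤ_[p], R x = fun i => PadicInt.toZMod (x i) := fun x => rfl
  have hF : Function.Surjective F := fun q => by
    have : ∀ i, ∃ z : ℤ_[p], PadicInt.toZMod z = q.toAdd i := fun i =>
      ZMod.ringHom_surjective (PadicInt.toZMod : ℤ_[p] →+* ZMod p) (q.toAdd i)
    choose z hz using this
    refine ⟨Multiplicative.ofAdd z, ?_⟩
    change Multiplicative.ofAdd (R z) = q
    rw [hR]
    simp_rw [hz]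
    exact ofAdd_toAdd q
  have hker : F.ker = (powMonoidHom p : Multiplicative (Fin d → ℤ_[p]) →*
      Multiplicative (Fin d → ℤ_[p])).range := by
    ext x
    simp only [MonoidHom.mem_ker, MonoidHom.mem_range, powMonoidHom_apply]
    change Multiplicative.ofAdd (R x.toAdd) = 1 ↔ _
    rw [ofAdd_eq_one, hR, funext_iff]
    constructor
    · intro h
      have h' : ∀ i, ∃ c : ℤ_[p], x.toAdd i = p * c := fun i => by
        have hi : PadicInt.toZMod (x.toAdd i) = 0 := h i
        rw [← RingHom.mem_ker, PadicInt.ker_toZMod, PadicInt.maximalIdeal_eq_span_p,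
          Ideal.mem_span_singleton] at hi
        exact hi
      choose c hc using h'
      refine ⟨Multiplicative.ofAdd c, ?_⟩
      rw [← ofAdd_nsmul, ← ofAdd_toAdd x]
      congr 1
      funext i
      rw [Pi.smul_apply, nsmul_eq_mul, ← hc i]
    · rintro ⟨y, rfl⟩ i
      change PadicInt.toZMod ((Multiplicative.toAdd (y ^ p)) i) = 0
      rw [← ofAdd_toAdd y, ← ofAdd_nsmul, toAdd_ofAdd, Pi.smul_apply, nsmul_eq_mul, map_mul,
        map_natCast, ZMod.natCast_self, zero_mul]
  rw [← hker, Subgroup.index_ker, MonoidHom.range_eq_top_of_surjective F hF, Subgroup.card_top]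
  rw [show Nat.card (Multiplicative (Fin d → ZMod p)) = Nat.card (Fin d → ZMod p) from
    Nat.card_congr Multiplicative.toAdd, Nat.card_fun, Nat.card_zmod, Nat.card_eq_fintype_card,
    Fintype.card_fin]

end PadicInt

/-! ## §2. The group-theoretic count -/

section Group

variable {G : Type*} [CommGroup G]

/-- `(G : Gᵖ)` is an isomorphism invariant. [cite: NeukirchANT1999, Ch. II Cor. (5.8) (proof)] -/
theorem index_pow_range_eq_of_mulEquiv' {H : Type*} [CommGroup H] (e : G ≃* H) (n : ℕ) :
    (powMonoidHom n : G →* G).range.index = (powMonoidHom n : H →* H).range.index := by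
  have h : (powMonoidHom n : G →* G).range =
      ((powMonoidHom n : H →* H).range).comap e.toMonoidHom := by
    ext g
    simp only [MonoidHom.mem_range, powMonoidHom_apply, Subgroup.mem_comap,
      MulEquiv.coe_toMonoidHom]
    constructor
    · rintro ⟨a, rfl⟩
      exact ⟨e a, by rw [map_pow]⟩
    · rintro ⟨b, hb⟩
      exact ⟨e.symm b, e.injective (by rw [map_pow, e.apply_symm_apply, hb])⟩
  rw [h]
  exact Subgroup.index_comap_of_surjective _ (f := e.toMonoidHom) e.surjective

/-- **The count.** `G` abelian, `f = (·)ⁿ : G → G` INJECTIVE, `W ≤ G` of finite index with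
`(W : Wⁿ) = m` (computed inside `W`). Then `(G : Gⁿ) = m`: `[G : Wⁿ] = [G : W]·m` and
`[G : Wⁿ] = [G : Gⁿ]·[Gⁿ : Wⁿ] = [G : Gⁿ]·[G : W]` (`f : G ≃ Gⁿ` carries `W` onto `Wⁿ`).
[cite: NeukirchANT1999, Ch. II Cor. (5.8) (proof)] -/
theorem index_pow_range_eq_of_injective_of_subgroup {n : ℕ}
    (hf : Function.Injective (powMonoidHom n : G →* G)) (W : Subgroup G) [W.FiniteIndex] {m : ℕ}
    (hW : (powMonoidHom n : W →* W).range.index = m) :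
    (powMonoidHom n : G →* G).range.index = m := by
  set f : G →* G := powMonoidHom n with hfdef
  set Wp : Subgroup G := W.map f with hWp
  -- `Wⁿ ≤ W`, `Wⁿ ≤ Gⁿ`
  have hWpW : Wp ≤ W := by
    rintro _ ⟨w, hw, rfl⟩
    exact W.pow_mem hw n
  have hWpR : Wp ≤ f.range := Subgroup.map_le_range f W
  -- `[W : Wⁿ] = m`
  have h1 : Wp.relIndex W = m := by
    rw [Subgroup.relIndex]
    have : Wp.subgroupOf W = (powMonoidHom n : W →* W).range := by
      ext w
      simp only [Subgroup.mem_subgroupOf, hWp, Subgroup.mem_map, MonoidHom.mem_range,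
        powMonoidHom_apply, hfdef]
      constructor
      · rintro ⟨w', hw', h⟩
        exact ⟨⟨w', hw'⟩, Subtype.ext (by simpa using h)⟩
      · rintro ⟨w', h⟩
        exact ⟨w', w'.2, by simpa using congrArg Subtype.val h⟩
    rw [this, hW]
  -- `[Gⁿ : Wⁿ] = [G : W]` through `f : G ≃ Gⁿ`
  have h2 : Wp.relIndex f.range = W.index := by
    let e : G ≃* f.range := MonoidHom.ofInjective hf
    have he : ∀ g : G, ((e g : f.range) : G) = f g := fun g => rfl
    rw [Subgroup.relIndex]
    have : Wp.subgroupOf f.range = W.comap e.symm.toMonoidHom := by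
      ext x
      simp only [Subgroup.mem_subgroupOf, hWp, Subgroup.mem_map, Subgroup.mem_comap,
        MulEquiv.coe_toMonoidHom]
      constructor
      · rintro ⟨w, hw, hx⟩
        have : e w = x := Subtype.ext (by rw [he]; exact hx)
        rw [← this, e.symm_apply_apply]
        exact hw
      · intro hx
        refine ⟨e.symm x, hx, ?_⟩
        rw [← he, e.apply_symm_apply]
    rw [this]
    exact Subgroup.index_comap_of_surjective _ (f := e.symm.toMonoidHom) e.symm.surjective
  -- the two factorizations of `[G : Wⁿ]`
  have hA : Wp.index = m * W.index := by
    rw [← Subgroup.relIndex_mul_index hWpW, h1]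
  have hB : Wp.index = W.index * f.range.index := by
    rw [← Subgroup.relIndex_mul_index hWpR, h2]
  have hN : W.index ≠ 0 := Subgroup.FiniteIndex.index_ne_zero
  have := hA.symm.trans hB
  rw [mul_comm] at this
  exact (mul_left_cancel₀ hN this).symm

end Group

/-! ## §3. `(U_K : U_K^p) = p^{[K:ℚ_p]}` -/

section LocalField

open ValuativeRel Literature.AnabelianGeometry.AbsoluteAnabelian

variable (p : ℕ) [Fact p.Prime]
variable (K : Type*) [Field K] [ValuativeRel K] [TopologicalSpace K] [IsNonarchimedeanLocalField K]
  [Algebra ℚ_[p] K] [FiniteDimensional ℚ_[p] K]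

/-- **Neukirch II (5.8) at `n = p` without `p`-torsion: `(U_K : U_Kᵖ) = p^{[K:ℚ_p]}`.** For a finite
extension `K/ℚ_p` (as a non-archimedean local field with its `ℚ_p`-algebra structure) whose unit group
`U_K = 𝒪_Kˣ` has no element of order `p`, the subgroup of `p`-th powers has index `p^{[K:ℚ_p]}`.
[cite: NeukirchANT1999, Ch. II Cor. (5.8)] -/
theorem index_pow_range_units_integer_eq (hμ : ∀ u : (𝒪[K])ˣ, u ^ p = 1 → u = 1) :
    (powMonoidHom p : (𝒪[K])ˣ →* (𝒪[K])ˣ).range.index = p ^ Module.finrank ℚ_[p] K := by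
  obtain ⟨W, -, hWfin, ⟨e⟩⟩ := exists_oneUnits_continuousMulEquiv p K
  haveI := hWfin
  have hf : Function.Injective (powMonoidHom p : (𝒪[K])ˣ →* (𝒪[K])ˣ) := by
    intro x y hxy
    have h : (x * y⁻¹) ^ p = 1 := by
      rw [mul_pow, inv_pow]
      have hx : x ^ p = y ^ p := hxy
      rw [hx, mul_inv_cancel]
    have := hμ _ h
    rwa [mul_inv_eq_one] at this
  refine index_pow_range_eq_of_injective_of_subgroup hf W ?_
  rw [index_pow_range_eq_of_mulEquiv' e.toMulEquiv p]
  exact index_pow_range_pi_padicInt (Module.finrank ℚ_[p] K)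

end LocalField

end Literature.NumberTheory.LocalFields

end
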